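import Summits.QuantumAdvantage.QuantumAdvantage.Theorems.CubicForrelationNearExactIsExactCubicFormR4ZLeafNF
import Summits.QuantumAdvantage.QuantumAdvantage.Theorems.CubicForrelationNearExactIsExactCubicFormR4ZLeafKer
import Summits.QuantumAdvantage.QuantumAdvantage.Theorems.CubicForrelationNearExactIsExactCubicFormR4ZLeafSp
import Summits.QuantumAdvantage.QuantumAdvantage.Theorems.CubicForrelationNearExactIsExactCubicFormR4ZLeafXi

/-!
# Crux `CubicForrelation.NearExactIsExact` (stmt-QuantumAdvantage-14043) — E1280-even, R4 branch: the d-level LEAF of descendant `0` PROVED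

Certificate seat `b2b-cforr-cert` (gen 43).  HONEST FRAMING: kernel-checked theorem (standard axioms).  `tq0_leaf` is LITERALLY the hypothesis
`HLEAF` of …CubicFormR4ZReduce `tpw_R4_zero_of_leaf` (so descendant `0` of the R4 dispatch, `HZ`, follows there): a cubic coefficient
tensor `d` on `𝔽₂^{5+7}` with a symmetric pairing partner `c` (`Σ_{j<k} c_pjk d_φjk = [p = φ]`), `d(y,·,·) = v₀∧v₁ + v₂∧v₃`,
`d|_{z×z×z} = 0`, `d(v_t,z_j,z_k) = a_t Ξ_jk` with `a ≠ 0`, and `d(v_t,v_t',z_j) = ω_tt' E_j + a_t M_t'j + a_t' M_tj` does not exist.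
PROOF: choose a symplectic `v`-frame adapted to `a` (…CubicFormR4ZLeafSp) and symplectic `z`-coordinates for `Ξ` (…CubicFormR4ZLeafXi,
`rank Ξ = 2h`, `h ≤ 3`); `h ≤ 1`: a kernel vector (…CubicFormR4ZLeafKer); `h ∈ {2,3}`: the normal form `y∧ω + v₀∧(Ξ' + Σ v_t∧Y_t)` and
the cores `tpa_R4_Z_rank4/6` of cert seat g39 (…CubicFormR4ZLeafNF).  This replaces E1280-HANDPROOFS §2.4 / fam_RZ (30 × 2²¹ enumeration)
by a proof.  Nothing about `θ₁₂` by itself; NOT summit progress.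

References: this seat lineage (g37 R4-PARTNER, g39 HANDPROOFS §2.4, g43 LEAN-GEN43).  Axioms: the standard three.
-/

set_option linter.dupNamespace false -- D-0017: single-problem summit ⇒ `QuantumAdvantage.QuantumAdvantage` by design

namespace Summit.QuantumAdvantage.QuantumAdvantage.Theorems.CubicForrelation.NearExactIsExact

open Finset

/-- **The d-level leaf of descendant `0`** — literally hypothesis `HLEAF` of `tpw_R4_zero_of_leaf`.  See the module docstring.
[this work] -/
theorem tq0_leaf :
    (∀ (c d : Fin (5 + 7) → Fin (5 + 7) → Fin (5 + 7) → ZMod 2),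
      (∀ p j k, c p k j = c p j k) → (∀ p j k, c j p k = c p j k) → (∀ p j, c p j j = 0) →
      (∀ φ j k, d φ k j = d φ j k) → (∀ φ j k, d j φ k = d φ j k) → (∀ φ j, d φ j j = 0) →
      (∀ p φ, (∑ j, ∑ k, (if j < k then c p j k * d φ j k else 0)) = if p = φ then 1 else 0) →
      (∀ j k, d (Fin.castAdd 7 (0 : Fin 5)) j k =
        (if (j = Fin.castAdd 7 (1 : Fin 5) ∧ k = Fin.castAdd 7 (2 : Fin 5)) ∨ (j = Fin.castAdd 7 (2 : Fin 5) ∧ k = Fin.castAdd 7 (1 : Fin 5)) then 1 else 0) +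
        (if (j = Fin.castAdd 7 (3 : Fin 5) ∧ k = Fin.castAdd 7 (4 : Fin 5)) ∨ (j = Fin.castAdd 7 (4 : Fin 5) ∧ k = Fin.castAdd 7 (3 : Fin 5)) then 1 else 0)) →
      (∀ σ τ υ : Fin 7, d (Fin.natAdd 5 σ) (Fin.natAdd 5 τ) (Fin.natAdd 5 υ) = 0) →
      ∀ (a : Fin 4 → ZMod 2), (∃ t, a t = 1) →
      ∀ (Ξ : Fin 7 → Fin 7 → ZMod 2), (∀ j k, Ξ k j = Ξ j k) → (∀ j, Ξ j j = 0) →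
      (∀ (t : Fin 4) (j k : Fin 7), d (Fin.castAdd 7 t.succ) (Fin.natAdd 5 j) (Fin.natAdd 5 k) = a t * Ξ j k) →
      ∀ (E : Fin 7 → ZMod 2) (M : Fin 4 → Fin 7 → ZMod 2),
      (∀ (t t' : Fin 4) (j : Fin 7), d (Fin.castAdd 7 t.succ) (Fin.castAdd 7 t'.succ) (Fin.natAdd 5 j) =
        ((if (t = 0 ∧ t' = 1) ∨ (t = 1 ∧ t' = 0) then (1 : ZMod 2) else 0) + (if (t = 2 ∧ t' = 3) ∨ (t = 3 ∧ t' = 2) then (1 : ZMod 2) else 0)) * E j + a t * M t' j + a t' * M t j) → False) := by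
  intro c d hcs hcc hcd hds hdc hdd hpair hF hzzz a ha Ξ hΞs hΞd hdΞ E M hdL
  obtain ⟨B, Bi, hBω, hBa, hBiB, -⟩ := tq5_sp_frame a ha
  obtain ⟨h, hh3, R, Ri, hRRi, hRiR, hRΞ⟩ := tq5_xi_frame Ξ hΞs hΞd
  by_cases hsmall : h ≤ 1
  · refine tq5_leaf_ker c d hds hdc hpair hF hzzz a ha Ξ hΞs hdΞ E M hdL R Ri hRRi hRiR (2 * h) (by omega) (fun s hs u => ?_)
    rw [hRΞ s u]
    refine Finset.sum_eq_zero fun i _ => ?_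
    have hi := i.isLt
    have h1 : ¬ (s.val = i.val) := by omega
    have h2 : ¬ (s.val = h + i.val) := by omega
    simp [h1, h2]
  · exact tq5_leaf_rank c d hcs hcc hcd hds hdc hdd hpair hF hzzz a Ξ hdΞ E M hdL B Bi hBω hBa hBiB R Ri hRiR h (by omega) hRΞ

end Summit.QuantumAdvantage.QuantumAdvantage.Theorems.CubicForrelation.NearExactIsExact
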